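import Summits.BirchSwinnertonDyer.BirchSwinnertonDyer.Theorems.ManinLocalTwoThreeTameThreeNeronScalarExists
import Summits.BirchSwinnertonDyer.BirchSwinnertonDyer.Theorems.ManinLocalTwoThreeThreeBlindCongruenceModNine
import HarnessLib

/-!
# A `3`-blind rational `3`-torsion point makes the Vélu `3`-quotient ASCEND (the dictionary (VÉLU₃♯) of the NB₃ branch,
# PROVED): `u(W → W/⟨T⟩) = 3`

Summit `BirchSwinnertonDyer`, route `ManinLocalTwoThree` (cell bsd-f2-manin), crux C3 `ManinPrimeToThreeAtNine`
(stmt-BirchSwinnertonDyer-22968), line `kato_shift_three`, stub NB₃ `NoBlindThreeTorsionOptimal`.  Sequel of the lead's `z⁹`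
congruence (p643768, `threeBlind_congruence_mod_nine`: a `3`-blind `T = (X₁, Y₁)` on `E♮ = E_{W,1}` has
`Y₁ ≡ 4(α/3)³ (mod 9)`) and of p3's Néron-scaling dichotomy (p644330, `exists_isGloballyMinimal_dvd_three_velu_three`: the
global minimal model `W'` of the Vélu `3`-quotient by a rational `3`-line carries `(k⁻⁴A, k⁻⁶B)`, `k ∣ 3`, where
`(A, B) = (1440X₁² − 9c₄, 60480X₁³ − 756c₄X₁ − 27c₆)` is the `u = 1` Vélu pair).

* §1 `padicValInt_minimalDiscriminantInt_le_padicValRat_Δ_smul_of_norm_le_one` — a globally minimal model minimises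
  `ord_p Δ` among all models with `p`-ADICALLY INTEGRAL rational coefficients (the `‖·‖_p ≤ 1` form of p625050 /
  p642603's `…_of_den`).
* §2 `not_exists_isGloballyMinimal_velu_three_of_congruence` — **THE LOCAL THEOREM**: for ANY `W/ℚ` with `3`-integral
  `a₄♮, a₆♮` and a rational point `T = (X₁, Y₁)` of order `3` on `E♮` satisfying the `z⁹` congruence
  `9 ∣ Y₁ − 4(α/3)³` (in `ℤ₃`), NO globally minimal curve carries the `u = 1` Vélu pair `(A, B)`.  Proof: translating `T`
  to the origin and shearing by the flex tangent gives the `3`-torsion chart `M₀ = [2α, 0, 2Y₁, 0, 0]` of `W` (`u = 1`),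
  whose Vélu quotient `[a₁, 0, a₃, −5a₁a₃, −a₁³a₃ − 7a₃²]` has invariants `(A, B)`; the change of variables
  `(u, r, s, t) = (3, −3κ², 0, (8κ³ − 9·(a₃ − κ³))/2)`, `κ = a₁/3 = 2α/3`, carries it to the UNIFORM descaled model
  `M″ = [2(α/3), −4(α/3)², 0, −2α·ν, −3ν²]`, `ν = (Y₁ − 4(α/3)³)/9`, with `3⁴c₄(M″) = A`, `3⁶c₆(M″) = B` (two ring
  identities modulo the flex relation `α² = 3X₁`), and `M″` is `3`-integral exactly when `α/3, ν ∈ ℤ₃` — the congruence.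
  A globally minimal `W'` with `(c₄, c₆) = (A, B)` is `ℚ`-isomorphic to `M″` (`exists_variableChange_of_c₄_eq_of_c₆_eq`), so
  §1 gives `ord₃ Δ_min(W') ≤ ord₃ Δ(M″) = ord₃ Δ(W') − 12`, absurd.  (This is the lead's chart law «λ(T) = 3 ⟺
  [v₃α = 1 ∧ Y₁ ≡ 4(α/3)³ (9)] ∨ [v₃α ≥ 2 ∧ v₃Y₁ = 2]» of HOME/p1/BL-scan-memo-p1-g5.md, 62 522 / 62 522, in closed form:
  both clauses say `9 ∣ a₃ − (a₁/3)³` on the chart, and the excluded sub-case `27 ∣ a₃, 9 ∣ a₁` is the non-minimal chart.)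
* §3 `exists_isGloballyMinimal_three_velu_three_of_congruence` — **(VÉLU₃♯) in p3's invariant language**: for `W/ℚ`
  globally minimal with `3`-integral `E♮` and a congruent `T`, some globally minimal `W'` has `3⁴c₄(W') = A`,
  `3⁶c₆(W') = B` — the Vélu `3`-quotient ASCENDS (`u = 3`; its Néron lattice is `3(Λ_W + ℤz_T)`, covolume `3·covol Λ_W`);
  `…_of_nine_dvd` (at a datum of level `9 ∣ N`, no integrality hypotheses) and
  `exists_isGloballyMinimal_three_velu_three_of_threeBlind_of_nine_dvd` (**blind ⟹ ascends**, via p643768).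
* §4 `noBlindThreeTorsionOptimal_of_noAscendingThreeTorsionOptimal` — **NB₃ ⟸ NB₃^V**: the registered stub
  `NoBlindThreeTorsionOptimal` of line `kato_shift_three` follows from the `c`-free OPTIMALITY law NB₃^V «no `X₀(N)`-optimal
  `W` with `9 ∣ N` has a rational point of order `3` whose Vélu `3`-quotient ascends» (stated inline as the hypothesis; cell
  census MEMO-an §67: 0 ascending rational-`3`-torsion edges out of 11 789 optimal curves with additive `3`, `N < 5·10⁵`;
  ⟸ Stevens' Conjecture II by refuter-1 §R66 Prop. 4) — the v13 composition edge of the C3 skeleton.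

HONEST FRAMING: local / model-theoretic theorems and one composition edge; C3, Manin's conjecture and BSD are NOT proved;
NB₃^V stays OPEN.  No definitions, no named facts, no sorry.

References: J. Vélu, *Isogénies entre courbes elliptiques*, C. R. Acad. Sci. Paris 273 (1971) 238–241; [SilvermanAEC2009]
III.1 Table 3.1 (changes of variables), VII.1 (minimal equations), VIII.8; [DokchitserDokchitser2015LocalInvariants] §4
Lemma 10–11 and Table 1 (row `l = p = 3`); cell memos HOME/p1/BL-scan-memo-p1-g5.md, HOME/MEMO-an.md §66–§67.
-/

set_option linter.dupNamespace false
set_option autoImplicit false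

noncomputable section

open scoped Classical

open WeierstrassCurve IsDedekindDomain NumberField Rat.HeightOneSpectrum Polynomial
  Literature.NumberTheory.DiophantineGeometry Literature.NumberTheory.EllipticCurves
  Literature.NumberTheory.EllipticCurves.ModularForms
  Summit.BirchSwinnertonDyer.Rank1Residual.ManinAdditive
  Summit.BirchSwinnertonDyer.Rank1Residual.ManinAdditive.CuspidalKummer
  Summit.BirchSwinnertonDyer.Rank1Residual.ManinAdditive.CuspidalKummerThree

namespace Summit.BirchSwinnertonDyer.BirchSwinnertonDyer.Theorems.ManinLocalTwoThree

/-! ### §1. A globally minimal model minimises `ord_p Δ` among `p`-adically integral models -/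

/-- **A globally minimal model minimises `ord_p Δ` among all `p`-ADICALLY INTEGRAL models**: if `W/ℚ` is globally minimal
and the five coefficients of `C • W` have `p`-adic norm `≤ 1`, then `ord_p Δ_min(W) ≤ ord_p Δ(C • W)` (`W ⊗ ℚ_p` is
`ℤ_p`-minimal, `isMinimal_baseChange_padic_of_isGloballyMinimal`, and `(C • W) ⊗ ℚ_p` is a `ℤ_p`-integral equation
`ℚ_p`-isomorphic to it).  [cite: SilvermanAEC2009, VII.1 (minimal equations) and VIII.8] -/
theorem padicValInt_minimalDiscriminantInt_le_padicValRat_Δ_smul_of_norm_le_one (W : WeierstrassCurve ℚ) [W.IsElliptic]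
    [W.IsGloballyMinimal] (C : VariableChange ℚ) (p : ℕ) [hp : Fact p.Prime]
    (h₁ : ‖(((C • W).a₁ : ℚ) : ℚ_[p])‖ ≤ 1) (h₂ : ‖(((C • W).a₂ : ℚ) : ℚ_[p])‖ ≤ 1)
    (h₃ : ‖(((C • W).a₃ : ℚ) : ℚ_[p])‖ ≤ 1) (h₄ : ‖(((C • W).a₄ : ℚ) : ℚ_[p])‖ ≤ 1)
    (h₆ : ‖(((C • W).a₆ : ℚ) : ℚ_[p])‖ ≤ 1) :
    (padicValInt p W.minimalDiscriminantInt : ℤ) ≤ padicValRat p (C • W).Δ := by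
  obtain ⟨v, hv⟩ := (Rat.HeightOneSpectrum.primesEquiv (R := 𝓞 ℚ)).surjective ⟨p, hp.out⟩
  have hvp : ((Rat.HeightOneSpectrum.primesEquiv v : Nat.Primes) : ℕ) = p := congrArg Subtype.val hv
  subst hvp
  haveI hmin := isMinimal_baseChange_padic_of_isGloballyMinimal W v
  set p : ℕ := ((Rat.HeightOneSpectrum.primesEquiv v : Nat.Primes) : ℕ) with hpdef
  set X : WeierstrassCurve ℚ_[p] := W.baseChange ℚ_[p] with hX
  set Y : WeierstrassCurve ℚ_[p] := (C • W).baseChange ℚ_[p] with hY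
  have hYX : Y = (C.map (algebraMap ℚ ℚ_[p])) • X := by
    rw [hY, hX, baseChange, baseChange, map_variableChange]
  have lift : ∀ a : ℚ, ‖(a : ℚ_[p])‖ ≤ 1 → ∃ r : ℤ_[p], algebraMap ℤ_[p] ℚ_[p] r = (a : ℚ_[p]) :=
    fun a ha ↦ ⟨⟨(a : ℚ_[p]), ha⟩, rfl⟩
  haveI hYint : Y.IsIntegral ℤ_[p] := by
    refine isIntegral_of_exists_lift ℤ_[p] ?_ ?_ ?_ ?_ ?_
    · simpa [hY, baseChange] using lift _ h₁
    · simpa [hY, baseChange] using lift _ h₂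
    · simpa [hY, baseChange] using lift _ h₃
    · simpa [hY, baseChange] using lift _ h₄
    · simpa [hY, baseChange] using lift _ h₆
  have hle : Padic.mulValuation Y.Δ ≤ Padic.mulValuation X.Δ := by
    have := ((isMinimal_iff_of_le_one_iff (padicMulValuation_le_one_iff (p := p)) X).mp hmin).2
      (C.map (algebraMap ℚ ℚ_[p])) (hYX ▸ hYint)
    rwa [← hYX] at this
  have hXΔ : X.Δ ≠ 0 := by
    rw [hX, baseChange, map_Δ]
    exact (_root_.map_ne_zero _).mpr W.isUnit_Δ.ne_zero
  have hYΔ' : Y.Δ = (((C • W).Δ : ℚ) : ℚ_[p]) := by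
    rw [hY, baseChange, map_Δ, eq_ratCast]
  have hCWΔ : (C • W).Δ ≠ 0 := (C • W).isUnit_Δ.ne_zero
  have hYΔ : Y.Δ ≠ 0 := by
    rw [hYΔ']
    exact_mod_cast hCWΔ
  rw [padicMulValuation_apply_of_ne_zero hYΔ, padicMulValuation_apply_of_ne_zero hXΔ,
    WithZero.exp_le_exp, neg_le_neg_iff, hX, padicValuation_Δ_baseChange_eq_padicValInt, hYΔ',
    Padic.valuation_ratCast] at hle
  exact hle

/-! ### §2. The local theorem: a congruent `3`-torsion point makes the `u = 1` Vélu pair non-minimal at `3` -/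

/-- The divisors of `3` in `ℤ`. [folklore] -/
theorem int_dvd_three_cases {k : ℤ} (hk : k ∣ 3) : k = 1 ∨ k = -1 ∨ k = 3 ∨ k = -3 := by
  have h1 : k.natAbs ∣ 3 := by exact_mod_cast Int.natAbs_dvd_natAbs.mpr hk
  have h2 : k.natAbs = 1 ∨ k.natAbs = 3 := (Nat.dvd_prime Nat.prime_three).mp h1
  omega

/-- **The invariants of `W` on the `3`-torsion chart**: for `T = (X₁, Y₁)` of order `3` on `E♮ = E_{W,1}` with tangent
slope `α`, `c₄(W) = 48(3X₁² − 2αY₁)` and `c₆(W) = 864(X₁³ + (2αY₁ − 3X₁²)X₁ − Y₁²)` (the chart `[2α, 0, 2Y₁, 0, 0]`, `u = 1`).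
[cite: SilvermanAEC2009, III.1 Table 3.1] -/
theorem c₄_c₆_eq_of_isShortThreeTorsion (W : WeierstrassCurve ℚ) {X₁ Y₁ : ℚ} (hT : IsShortThreeTorsion W 1 X₁ Y₁) :
    W.c₄ = 48 * (3 * X₁ ^ 2 - 2 * tangentSlope W 1 X₁ Y₁ * Y₁) ∧
      W.c₆ = 864 * (X₁ ^ 3 + (2 * tangentSlope W 1 X₁ Y₁ * Y₁ - 3 * X₁ ^ 2) * X₁ - Y₁ ^ 2) := by
  have hY := y_ne_zero_of_isShortThreeTorsion hT
  have heq := equation_of_isShortThreeTorsion hT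
  have ha4 : (shortModel W 1).a₄ = -(W.c₄ / 48) := by simp [shortModel]
  have ha6 : (shortModel W 1).a₆ = -(W.c₆ / 864) := by simp [shortModel]
  have h2 : tangentSlope W 1 X₁ Y₁ * (2 * Y₁) = 3 * X₁ ^ 2 + (shortModel W 1).a₄ := by
    rw [tangentSlope, div_mul_cancel₀ _ (mul_ne_zero two_ne_zero hY)]
  rw [ha4] at h2
  rw [ha4, ha6] at heq
  constructor
  · linear_combination 48 * h2
  · linear_combination 864 * heq - 864 * X₁ * h2

/-- **THE LOCAL THEOREM (the `u = 1` Vélu pair of a congruent `3`-torsion point is not a minimal pair).**  For ANY `W/ℚ`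
with `3`-integral `a₄♮, a₆♮` and a rational point `T = (X₁, Y₁)` of order `3` on `E♮` satisfying the `z⁹` congruence
`Y₁ ≡ 4(α/3)³ (mod 9)` in `ℤ₃`, NO globally minimal `W'/ℚ` has `c₄(W') = 1440X₁² − 9c₄(W)` and
`c₆(W') = 60480X₁³ − 756c₄(W)X₁ − 27c₆(W)`: the explicit model `M″ = [2(α/3), −4(α/3)², 0, −2αν, −3ν²]`,
`ν = (Y₁ − 4(α/3)³)/9`, is `3`-integral with `3⁴c₄(M″) = c₄(W')`, `3⁶c₆(M″) = c₆(W')`, so `W' ≅_ℚ M″` and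
`ord₃ Δ_min(W') ≤ ord₃ Δ(M″) = ord₃ Δ(W') − 12`.  [cite: SilvermanAEC2009, III.1 Table 3.1 and VII.1] -/
theorem not_exists_isGloballyMinimal_velu_three_of_congruence (W : WeierstrassCurve ℚ)
    (hA : ‖(((shortModel W 1).a₄ : ℚ) : ℚ_[3])‖ ≤ 1) (hB : ‖(((shortModel W 1).a₆ : ℚ) : ℚ_[3])‖ ≤ 1)
    {X₁ Y₁ : ℚ} (hT : IsShortThreeTorsion W 1 X₁ Y₁)
    (hcong : ‖(((Y₁ - 4 * (tangentSlope W 1 X₁ Y₁ / 3) ^ 3) / 9 : ℚ) : ℚ_[3])‖ ≤ 1) :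
    ¬ ∃ W' : WeierstrassCurve ℚ, W'.IsElliptic ∧ W'.IsGloballyMinimal ∧
        W'.c₄ = 1440 * X₁ ^ 2 - 9 * W.c₄ ∧ W'.c₆ = 60480 * X₁ ^ 3 - 756 * W.c₄ * X₁ - 27 * W.c₆ := by
  rintro ⟨W', hW'e, hW'm, h4, h6⟩
  obtain ⟨hX, -⟩ := norm_le_one_of_isShortThreeTorsion W hA hB hT
  have hs := norm_tangentSlope_div_three_le_one hT hX
  have hαn := norm_tangentSlope_le_one hT hX
  have hflex := tangentSlope_sq_eq_three_mul hT
  obtain ⟨hc4, hc6⟩ := c₄_c₆_eq_of_isShortThreeTorsion W hT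
  set α := tangentSlope W 1 X₁ Y₁ with hαdef
  -- the uniform descaled model of the Vélu quotient
  obtain ⟨M, hM⟩ : ∃ M : WeierstrassCurve ℚ,
      M = ⟨2 * (α / 3), -(4 * (α / 3) ^ 2), 0, -(2 * α * ((Y₁ - 4 * (α / 3) ^ 3) / 9)),
        -(3 * ((Y₁ - 4 * (α / 3) ^ 3) / 9) ^ 2)⟩ := ⟨_, rfl⟩
  have h81 : (3 : ℚ) ^ 4 * M.c₄ = W'.c₄ := by
    rw [h4, hc4, hM]
    simp only [WeierstrassCurve.c₄, WeierstrassCurve.b₂, WeierstrassCurve.b₄]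
    linear_combination (16 * α ^ 2 + 48 * X₁) * hflex
  have h729 : (3 : ℚ) ^ 6 * M.c₆ = W'.c₆ := by
    rw [h6, hc4, hc6, hM]
    simp only [WeierstrassCurve.c₆, WeierstrassCurve.b₂, WeierstrassCurve.b₄, WeierstrassCurve.b₆]
    linear_combination (-64 * α ^ 4 - 192 * X₁ * α ^ 2 - 576 * X₁ ^ 2 + 8640 * Y₁ * α) * hflex
  have hM4 : M.c₄ = (3 ^ 4)⁻¹ * W'.c₄ := by rw [← h81]; ring
  have hM6 : M.c₆ = (3 ^ 6)⁻¹ * W'.c₆ := by rw [← h729]; ring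
  obtain ⟨C, hC⟩ := exists_variableChange_of_c₄_eq_of_c₆_eq (W₁ := W') (W₂ := M) (w := 3) three_ne_zero hM4 hM6
  -- `M` is `3`-integral: minimality of `W'` at `3`
  haveI : Fact (Nat.Prime 3) := ⟨Nat.prime_three⟩
  have hn2 : ‖(2 : ℚ_[3])‖ ≤ 1 := by have := Padic.norm_int_le_one (p := 3) 2; exact_mod_cast this
  have hn3 : ‖(3 : ℚ_[3])‖ ≤ 1 := by have := Padic.norm_int_le_one (p := 3) 3; exact_mod_cast this
  have hn4 : ‖(4 : ℚ_[3])‖ ≤ 1 := by have := Padic.norm_int_le_one (p := 3) 4; exact_mod_cast this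
  set s : ℚ_[3] := ((α / 3 : ℚ) : ℚ_[3]) with hsdef
  set n : ℚ_[3] := (((Y₁ - 4 * (α / 3) ^ 3) / 9 : ℚ) : ℚ_[3]) with hndef
  have hle := padicValInt_minimalDiscriminantInt_le_padicValRat_Δ_smul_of_norm_le_one W' C 3
    (by
      rw [hC, hM]
      have e : ((2 * (α / 3) : ℚ) : ℚ_[3]) = 2 * s := by rw [hsdef]; push_cast; ring
      rw [e, norm_mul]
      exact mul_le_one₀ hn2 (norm_nonneg _) hs)
    (by
      rw [hC, hM]
      have e : ((-(4 * (α / 3) ^ 2) : ℚ) : ℚ_[3]) = -(4 * s ^ 2) := by rw [hsdef]; push_cast; ring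
      rw [e, norm_neg, norm_mul, norm_pow]
      exact mul_le_one₀ hn4 (pow_nonneg (norm_nonneg _) _) (pow_le_one₀ (norm_nonneg _) hs))
    (by rw [hC, hM]; simp)
    (by
      rw [hC, hM]
      have e : ((-(2 * α * ((Y₁ - 4 * (α / 3) ^ 3) / 9)) : ℚ) : ℚ_[3]) = -(2 * ((α : ℚ) : ℚ_[3]) * n) := by
        rw [hndef]; push_cast; ring
      rw [e, norm_neg, norm_mul, norm_mul]
      exact mul_le_one₀ (mul_le_one₀ hn2 (norm_nonneg _) hαn) (norm_nonneg _) hcong)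
    (by
      rw [hC, hM]
      have e : ((-(3 * ((Y₁ - 4 * (α / 3) ^ 3) / 9) ^ 2) : ℚ) : ℚ_[3]) = -(3 * n ^ 2) := by
        rw [hndef]; push_cast; ring
      rw [e, norm_neg, norm_mul, norm_pow]
      exact mul_le_one₀ hn3 (pow_nonneg (norm_nonneg _) _) (pow_le_one₀ (norm_nonneg _) hcong))
  -- but `Δ(M) = 3⁻¹² Δ(W') = 3⁻¹² Δ_min(W')`
  haveI := hW'e
  haveI := hW'm
  have hΔM : (C • W').Δ = (3 : ℚ)⁻¹ ^ 12 * (W'.minimalDiscriminantInt : ℚ) := by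
    rw [hC, cast_minimalDiscriminantInt]
    have h1 := M.c_relation
    have h2 := W'.c_relation
    rw [hM4, hM6] at h1
    linear_combination h1 / 1728 - h2 / (1728 * 3 ^ 12)
  have hm0 : (W'.minimalDiscriminantInt : ℚ) ≠ 0 := by exact_mod_cast minimalDiscriminantInt_ne_zero W'
  rw [hΔM, padicValRat.mul (pow_ne_zero _ (inv_ne_zero three_ne_zero)) hm0, padicValRat.pow,
    padicValRat.inv, padicValRat.of_int] at hle
  have h3v : padicValRat 3 (3 : ℚ) = 1 := by exact_mod_cast padicValRat.self (p := 3) (by norm_num)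
  rw [h3v] at hle
  push_cast at hle
  linarith

/-! ### §3. (VÉLU₃♯): a congruent / blind rational `3`-torsion point makes the Vélu quotient ascend -/

/-- **(VÉLU₃♯) — the Vélu `3`-quotient by a congruent rational `3`-torsion point ASCENDS.**  `W/ℚ` globally minimal with
`3`-integral `a₄♮, a₆♮`; `T = (X₁, Y₁)` of order `3` on `E♮` with `Y₁ ≡ 4(α/3)³ (mod 9)`.  Then some globally minimal `W'/ℚ`
has `3⁴c₄(W') = 1440X₁² − 9c₄(W)` and `3⁶c₆(W') = 60480X₁³ − 756c₄(W)X₁ − 27c₆(W)` — the global minimal model of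
`W/⟨T⟩` carries `(3⁻⁴A, 3⁻⁶B)`, i.e. `u(W → W/⟨T⟩) = 3` (p3's dichotomy `exists_isGloballyMinimal_dvd_three_velu_three`,
the branch `k = ±1` being excluded by §2).  [cite: DokchitserDokchitser2015LocalInvariants, §4 Lemma 10–11 and Table 1]
[cite: SilvermanAEC2009, III.4.12 and VII.1] -/
theorem exists_isGloballyMinimal_three_velu_three_of_congruence (W : WeierstrassCurve ℚ) [W.IsElliptic]
    [W.IsGloballyMinimal] (hA : ‖(((shortModel W 1).a₄ : ℚ) : ℚ_[3])‖ ≤ 1)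
    (hB : ‖(((shortModel W 1).a₆ : ℚ) : ℚ_[3])‖ ≤ 1) {X₁ Y₁ : ℚ} (hT : IsShortThreeTorsion W 1 X₁ Y₁)
    (hcong : ‖(((Y₁ - 4 * (tangentSlope W 1 X₁ Y₁ / 3) ^ 3) / 9 : ℚ) : ℚ_[3])‖ ≤ 1) :
    ∃ W' : WeierstrassCurve ℚ, W'.IsElliptic ∧ W'.IsGloballyMinimal ∧
      (3 : ℚ) ^ 4 * W'.c₄ = 1440 * X₁ ^ 2 - 9 * W.c₄ ∧
      (3 : ℚ) ^ 6 * W'.c₆ = 60480 * X₁ ^ 3 - 756 * W.c₄ * X₁ - 27 * W.c₆ := by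
  -- the rational root of `Ψ₃` in `W`'s coordinates
  have hsm : shortModel W 1 = (⟨0, 0, 0, -W.c₄ / 48, -W.c₆ / 864⟩ : WeierstrassCurve ℚ) := by
    ext <;> simp [shortModel] <;> ring
  have hq : W.Ψ₃.eval (X₁ - W.b₂ / 12) = 0 := by
    rw [Ψ₃_eval_sub_b₂_div_twelve, ← hsm]
    exact hT.2.eq_zero
  -- the pair is nonsingular (Bézout against `Ψ₃`, p3's `velu_three_discr_ne_zero`)
  have hne : (1440 * X₁ ^ 2 - 9 * W.c₄) ^ 3 ≠ (60480 * X₁ ^ 3 - 756 * W.c₄ * X₁ - 27 * W.c₆) ^ 2 := by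
    have hq' := hq
    rw [Ψ₃_eval_sub_b₂_div_twelve] at hq'
    simp only [WeierstrassCurve.Ψ₃, WeierstrassCurve.b₂, WeierstrassCurve.b₄, WeierstrassCurve.b₆, WeierstrassCurve.b₈,
      eval_add, eval_mul, eval_pow, eval_C, eval_X, eval_ofNat] at hq'
    have hψ : 48 * X₁ ^ 4 - 24 * (W.c₄ / 12) * X₁ ^ 2 - 48 * (W.c₆ / 216) * X₁ - (W.c₄ / 12) ^ 2 = 0 := by
      linear_combination 16 * hq'
    have hΔ₀ : (W.c₄ / 12) ^ 3 - 27 * (W.c₆ / 216) ^ 2 ≠ 0 := by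
      have hΔW : W.Δ ≠ 0 := by rw [← WeierstrassCurve.coe_Δ']; exact W.Δ'.ne_zero
      intro h0; apply hΔW
      linear_combination W.c_relation / 1728 + h0
    have h := velu_three_discr_ne_zero hψ hΔ₀
    intro heq; apply h
    linear_combination heq / 1728
  obtain ⟨W', k, hW'e, hW'm, hk3, h4, h6⟩ := exists_isGloballyMinimal_dvd_three_velu_three W X₁ hq hne
  have hno := not_exists_isGloballyMinimal_velu_three_of_congruence W hA hB hT hcong
  rcases int_dvd_three_cases hk3 with rfl | rfl | rfl | rfl
  · exact absurd ⟨W', hW'e, hW'm, by linear_combination h4, by linear_combination h6⟩ hno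
  · exfalso
    refine hno ⟨W', hW'e, hW'm, ?_, ?_⟩
    · rw [← h4]; push_cast; ring
    · rw [← h6]; push_cast; ring
  · exact ⟨W', hW'e, hW'm, by exact_mod_cast h4, by exact_mod_cast h6⟩
  · refine ⟨W', hW'e, hW'm, ?_, ?_⟩
    · rw [← h4]; push_cast; ring
    · rw [← h6]; push_cast; ring

/-- **(VÉLU₃♯) at a datum of level `9 ∣ N`** (no integrality hypotheses: additive reduction at `3` makes `E♮` `3`-integral,
`norm_shortModel_le_one_of_nine_dvd`). [cite: DokchitserDokchitser2015LocalInvariants, §4 Lemma 10–11 and Table 1] -/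
theorem exists_isGloballyMinimal_three_velu_three_of_congruence_of_nine_dvd (W : WeierstrassCurve ℚ) [W.IsElliptic]
    [W.IsGloballyMinimal] {N : ℕ} [NeZero N] (D : ModularParametrizationData W N) (h9 : 9 ∣ N) {X₁ Y₁ : ℚ}
    (hT : IsShortThreeTorsion W 1 X₁ Y₁)
    (hcong : ‖(((Y₁ - 4 * (tangentSlope W 1 X₁ Y₁ / 3) ^ 3) / 9 : ℚ) : ℚ_[3])‖ ≤ 1) :
    ∃ W' : WeierstrassCurve ℚ, W'.IsElliptic ∧ W'.IsGloballyMinimal ∧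
      (3 : ℚ) ^ 4 * W'.c₄ = 1440 * X₁ ^ 2 - 9 * W.c₄ ∧
      (3 : ℚ) ^ 6 * W'.c₆ = 60480 * X₁ ^ 3 - 756 * W.c₄ * X₁ - 27 * W.c₆ := by
  obtain ⟨hA, hB⟩ := norm_shortModel_le_one_of_nine_dvd W D h9
  exact exists_isGloballyMinimal_three_velu_three_of_congruence W hA hB hT hcong

/-- **A `3`-BLIND rational `3`-torsion point makes the Vélu `3`-quotient ASCEND** (at a datum of level `9 ∣ N`): blind ⟹
`Y₁ ≡ 4(α/3)³ (mod 9)` (`threeBlind_congruence_mod_nine_of_nine_dvd`, p643768) ⟹ `u(W → W/⟨T⟩) = 3`.  The converse of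
refuter-1's Lemma 2 «`λ(T) = 3 ⟹ T` blind» (§R66); together: **blind ⟺ ascending** on the optimal locus' vocabulary.
[cite: DokchitserDokchitser2015LocalInvariants, §4 Lemma 10–11 and Table 1] -/
theorem exists_isGloballyMinimal_three_velu_three_of_threeBlind_of_nine_dvd (W : WeierstrassCurve ℚ) [W.IsElliptic]
    [W.IsGloballyMinimal] {N : ℕ} [NeZero N] (D : ModularParametrizationData W N) (h9 : 9 ∣ N) {X₁ Y₁ : ℚ}
    (hT : IsShortThreeTorsion W 1 X₁ Y₁) (hb : ThreeBlind W X₁ Y₁) :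
    ∃ W' : WeierstrassCurve ℚ, W'.IsElliptic ∧ W'.IsGloballyMinimal ∧
      (3 : ℚ) ^ 4 * W'.c₄ = 1440 * X₁ ^ 2 - 9 * W.c₄ ∧
      (3 : ℚ) ^ 6 * W'.c₆ = 60480 * X₁ ^ 3 - 756 * W.c₄ * X₁ - 27 * W.c₆ :=
  exists_isGloballyMinimal_three_velu_three_of_congruence_of_nine_dvd W D h9 hT
    (threeBlind_congruence_mod_nine_of_nine_dvd W D h9 hT hb)

/-! ### §4. NB₃ ⟸ NB₃^V (the v13 composition edge of line `kato_shift_three`) -/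

/-- **NB₃ ⟸ NB₃^V.**  The registered stub NB₃ `NoBlindThreeTorsionOptimal` («no `X₀(N)`-optimal `W` with `9 ∣ N` carries a
`3`-blind rational point of order `3` on `E♮`») follows from the `c`-free OPTIMALITY law NB₃^V, stated here as the
hypothesis: «no `X₀(N)`-optimal `W` with `9 ∣ N` has a rational point `T` of order `3` on `E♮` whose Vélu `3`-quotient
ASCENDS», i.e. no globally minimal curve carries `(3⁻⁴A, 3⁻⁶B)` for `T`'s `u = 1` Vélu pair `(A, B)` (cell census MEMO-an
§67: 0 / 11 789 optimal curves with additive `3`, `N < 5·10⁵`; implied by Stevens' Conjecture II, refuter-1 §R66 Prop. 4;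
OPEN).  [cite: Stevens1989, Conjecture II (the optimality input NB₃^V is implied by it; cell memo REFUTER-ref1 §R66)] -/
theorem noBlindThreeTorsionOptimal_of_noAscendingThreeTorsionOptimal
    (hV : ∀ (W : WeierstrassCurve ℚ) [W.IsElliptic] [W.IsGloballyMinimal] {N : ℕ} [NeZero N]
      (D : ModularParametrizationData W N),
      (∀ z ∈ D.L.lattice, ∃ w ∈ periodLattice D.f, z = D.c * w) → 9 ∣ N →
      ∀ X₁ Y₁ : ℚ, IsShortThreeTorsion W 1 X₁ Y₁ →
      ¬ ∃ W' : WeierstrassCurve ℚ, W'.IsElliptic ∧ W'.IsGloballyMinimal ∧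
          (3 : ℚ) ^ 4 * W'.c₄ = 1440 * X₁ ^ 2 - 9 * W.c₄ ∧
          (3 : ℚ) ^ 6 * W'.c₆ = 60480 * X₁ ^ 3 - 756 * W.c₄ * X₁ - 27 * W.c₆) :
    NoBlindThreeTorsionOptimal := by
  intro W _ _ N _ D hL h9 X₁ Y₁ hT hb
  exact hV W D hL h9 X₁ Y₁ hT (exists_isGloballyMinimal_three_velu_three_of_threeBlind_of_nine_dvd W D h9 hT hb)

end Summit.BirchSwinnertonDyer.BirchSwinnertonDyer.Theorems.ManinLocalTwoThree

end
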